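import Mathlib.RingTheory.MvPowerSeries.Basic
import Mathlib.RingTheory.AdicCompletion.Basic
import Mathlib.Tactic.LinearCombination
import HarnessLib

/-!
# The formal Morse lemma for the node `uv` over an adically complete ring (de Jong 1996, 2.23)

Topic: `Literature/AlgebraicGeometry/Resolution`. A brick of the formal structure of split
semi-stable curves, de Jong 1996, 2.23 — the sentence

> "By flatness of `B` over `A'`, we see that `B ≅ A'⟦u, v⟧/(Q - h)` for some
> `h ∈ 𝔪_{A'} A'⟦u, v⟧`. Rechoosing the coordinates `u, v ∈ B` appropriately, using that
> `discr(q) ≠ 0`, we see that we may assume `h ∈ A'`. (One may also prove this by showing that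
> the minimal versal deformation space of the singularity `k'⟦u, v⟧/(q)` is one-dimensional.)"
> (p. 61)

in the split case `Q = uv`, as an identity of power series which produces the new coordinates
without any substitution: for a ring `Λ` complete and separated in its `𝔪`-adic topology and a
power series `H ∈ Λ⟦u, v⟧` with all coefficients in `𝔪`, there are power series `α, β, ε` with
coefficients in `𝔪` and a constant `h ∈ 𝔪` with

  `(1 + ε) · (uv - H) = (u + α)(v + β) - h`          (`exists_formalMorse_node`).

Hence in `Λ⟦u, v⟧/(uv - H)` the elements `u' = u + α`, `v' = v + β` (congruent to `u, v` modulo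
`𝔪`) satisfy `u'v' = h ∈ 𝔪 ⊆ Λ`, which is how the statement is consumed in the proof of 2.23/3.3
(the presentation on the coordinates `u', v'` then has kernel `(u'v' - h)` by the same flatness
argument, so no automorphism of `Λ⟦u, v⟧` is needed).

Proof (successive approximation, all PROVED here): every `F ∈ Λ⟦u, v⟧` decomposes uniquely as
`F = F₀₀ + u·[F]ᵤ + v·[F]ᵥ + uv·[F]ᵤᵥ` with `[F]ᵤ ∈ Λ⟦u⟧`, `[F]ᵥ ∈ Λ⟦v⟧` (`nodePartU`,
`nodePartV`, `nodePartUV`, `node_decompose`). The map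
`Θ(α, β, ε) = (-[N]ᵥ, -[N]ᵤ, [N]ᵤᵥ)`, `N = H + αβ + εH`, contracts: if two triples with
coefficients in `𝔪` agree modulo `J` coefficientwise then their images agree modulo `𝔪J`
(`coeffIdeal_morseN_sub`). Its iterates from `0` are therefore Cauchy coefficientwise, converge
coefficientwise (`IsPrecomplete`), and the limit is a fixed point (`IsHausdorff`); for a fixed
point, `h = N₀₀` and the decomposition of `N` give the identity.

Also provided: the ideal `MvPowerSeries.coeffIdeal I` of power series with all coefficients
in `I` and its arithmetic (`coeffIdeal I * coeffIdeal J ≤ coeffIdeal (I * J)`).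

## Sources

* A. J. de Jong, *Smoothness, semi-stability and alterations*, Publ. Math. IHÉS 83 (1996),
  2.23, pp. 61–62. [DeJong1996]
-/

noncomputable section

namespace Literature.AlgebraicGeometry.Resolution

universe u v

/-! ## Power series with coefficients in an ideal -/

section CoeffIdeal

variable {σ : Type v} {Λ : Type u} [CommRing Λ]

/-- The ideal of power series all of whose coefficients lie in the ideal `I` (for a finitely
generated `I` this is the extension `I · Λ⟦X⟧`; in general it is larger). [folklore] -/
def MvPowerSeries.coeffIdeal (I : Ideal Λ) : Ideal (MvPowerSeries σ Λ) where
  carrier := {F | ∀ d, MvPowerSeries.coeff d F ∈ I}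
  add_mem' {F G} hF hG d := by
    rw [map_add]
    exact I.add_mem (hF d) (hG d)
  zero_mem' d := by
    rw [map_zero]
    exact I.zero_mem
  smul_mem' F G hG d := by
    classical
    rw [smul_eq_mul, MvPowerSeries.coeff_mul]
    exact I.sum_mem fun p _ => I.mul_mem_left _ (hG p.2)

/-- Membership in `coeffIdeal I` is coefficientwise. [folklore] -/
theorem MvPowerSeries.mem_coeffIdeal_iff {I : Ideal Λ} {F : MvPowerSeries σ Λ} :
    F ∈ MvPowerSeries.coeffIdeal I ↔ ∀ d, MvPowerSeries.coeff d F ∈ I :=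
  Iff.rfl

/-- `coeffIdeal` is monotone. [folklore] -/
theorem MvPowerSeries.coeffIdeal_mono {I J : Ideal Λ} (h : I ≤ J) :
    (MvPowerSeries.coeffIdeal I : Ideal (MvPowerSeries σ Λ)) ≤ MvPowerSeries.coeffIdeal J :=
  fun _ hF d => h (hF d)

/-- Products: `coeffIdeal I * coeffIdeal J ≤ coeffIdeal (I * J)` — each coefficient of `FG` is
a sum of products of a coefficient of `F` and one of `G`. [folklore] -/
theorem MvPowerSeries.mul_mem_coeffIdeal_mul {I J : Ideal Λ} {F G : MvPowerSeries σ Λ}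
    (hF : F ∈ MvPowerSeries.coeffIdeal I) (hG : G ∈ MvPowerSeries.coeffIdeal J) :
    F * G ∈ MvPowerSeries.coeffIdeal (I * J) := by
  classical
  intro d
  rw [MvPowerSeries.coeff_mul]
  exact sum_mem fun p _ => Ideal.mul_mem_mul (hF p.1) (hG p.2)

/-- A constant lies in `coeffIdeal I` iff it lies in `I`. [folklore] -/
theorem MvPowerSeries.C_mem_coeffIdeal_iff {I : Ideal Λ} {a : Λ} :
    (MvPowerSeries.C a : MvPowerSeries σ Λ) ∈ MvPowerSeries.coeffIdeal I ↔ a ∈ I := by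
  classical
  constructor
  · intro h
    simpa [MvPowerSeries.coeff_C] using h 0
  · intro h d
    rw [MvPowerSeries.coeff_C]
    split_ifs
    · exact h
    · exact I.zero_mem

/-- The constant coefficient of a member of `coeffIdeal I` lies in `I`. [folklore] -/
theorem MvPowerSeries.constantCoeff_mem_of_mem_coeffIdeal {I : Ideal Λ} {F : MvPowerSeries σ Λ}
    (hF : F ∈ MvPowerSeries.coeffIdeal I) : MvPowerSeries.constantCoeff F ∈ I := by
  rw [← MvPowerSeries.coeff_zero_eq_constantCoeff_apply]
  exact hF 0

/-- In the ring `Λ` viewed as a module over itself, congruence modulo `Iⁿ • ⊤` is membership of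
the difference in `Iⁿ`. [folklore] -/
theorem smodEq_pow_smul_top_iff {I : Ideal Λ} {n : ℕ} {x y : Λ} :
    x ≡ y [SMOD (I ^ n • ⊤ : Submodule Λ Λ)] ↔ x - y ∈ I ^ n := by
  rw [SModEq.sub_mem, smul_eq_mul, Ideal.mul_top]

end CoeffIdeal

/-! ## The decomposition `F = F₀₀ + u·[F]ᵤ + v·[F]ᵥ + uv·[F]ᵤᵥ` in `Λ⟦u, v⟧` -/

namespace DeJong1996

variable {Λ : Type u} [CommRing Λ]

/-- `[F]ᵤ = Σ_{a ≥ 0} F_{(a+1, 0)} uᵃ`: the terms of `F ∈ Λ⟦u, v⟧` involving `u` but not `v`,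
divided by `u` (`u = X 0`, `v = X 1`). [folklore] -/
def nodePartU (F : MvPowerSeries (Fin 2) Λ) : MvPowerSeries (Fin 2) Λ :=
  fun d => if d 1 = 0 then MvPowerSeries.coeff (d + Finsupp.single 0 1) F else 0

/-- `[F]ᵥ = Σ_{b ≥ 0} F_{(0, b+1)} vᵇ`: the terms involving `v` but not `u`, divided by `v`.
[folklore] -/
def nodePartV (F : MvPowerSeries (Fin 2) Λ) : MvPowerSeries (Fin 2) Λ :=
  fun d => if d 0 = 0 then MvPowerSeries.coeff (d + Finsupp.single 1 1) F else 0

/-- `[F]ᵤᵥ = Σ_{a, b ≥ 0} F_{(a+1, b+1)} uᵃ vᵇ`: the terms involving both `u` and `v`, divided by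
`uv`. [folklore] -/
def nodePartUV (F : MvPowerSeries (Fin 2) Λ) : MvPowerSeries (Fin 2) Λ :=
  fun d => MvPowerSeries.coeff (d + Finsupp.single 0 1 + Finsupp.single 1 1) F

/-- Coefficients of `[F]ᵤ`. [folklore] -/
theorem coeff_nodePartU (F : MvPowerSeries (Fin 2) Λ) (d : Fin 2 →₀ ℕ) :
    MvPowerSeries.coeff d (nodePartU F) =
      if d 1 = 0 then MvPowerSeries.coeff (d + Finsupp.single 0 1) F else 0 :=
  rfl

/-- Coefficients of `[F]ᵥ`. [folklore] -/
theorem coeff_nodePartV (F : MvPowerSeries (Fin 2) Λ) (d : Fin 2 →₀ ℕ) :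
    MvPowerSeries.coeff d (nodePartV F) =
      if d 0 = 0 then MvPowerSeries.coeff (d + Finsupp.single 1 1) F else 0 :=
  rfl

/-- Coefficients of `[F]ᵤᵥ`. [folklore] -/
theorem coeff_nodePartUV (F : MvPowerSeries (Fin 2) Λ) (d : Fin 2 →₀ ℕ) :
    MvPowerSeries.coeff d (nodePartUV F) =
      MvPowerSeries.coeff (d + Finsupp.single 0 1 + Finsupp.single 1 1) F :=
  rfl

/-- `[·]ᵤ` is additive: `[F - G]ᵤ = [F]ᵤ - [G]ᵤ`. [folklore] -/
theorem nodePartU_sub (F G : MvPowerSeries (Fin 2) Λ) :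
    nodePartU (F - G) = nodePartU F - nodePartU G := by
  ext d
  simp only [map_sub, coeff_nodePartU]
  split_ifs <;> simp

/-- `[·]ᵥ` is additive. [folklore] -/
theorem nodePartV_sub (F G : MvPowerSeries (Fin 2) Λ) :
    nodePartV (F - G) = nodePartV F - nodePartV G := by
  ext d
  simp only [map_sub, coeff_nodePartV]
  split_ifs <;> simp

/-- `[·]ᵤᵥ` is additive. [folklore] -/
theorem nodePartUV_sub (F G : MvPowerSeries (Fin 2) Λ) :
    nodePartUV (F - G) = nodePartUV F - nodePartUV G := by
  ext d
  simp only [map_sub, coeff_nodePartUV]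

/-- `[·]ᵤ` preserves "all coefficients in `I`". [folklore] -/
theorem nodePartU_mem_coeffIdeal {I : Ideal Λ} {F : MvPowerSeries (Fin 2) Λ}
    (hF : F ∈ MvPowerSeries.coeffIdeal I) : nodePartU F ∈ MvPowerSeries.coeffIdeal I := by
  intro d
  rw [coeff_nodePartU]
  split_ifs
  · exact hF _
  · exact I.zero_mem

/-- `[·]ᵥ` preserves "all coefficients in `I`". [folklore] -/
theorem nodePartV_mem_coeffIdeal {I : Ideal Λ} {F : MvPowerSeries (Fin 2) Λ}
    (hF : F ∈ MvPowerSeries.coeffIdeal I) : nodePartV F ∈ MvPowerSeries.coeffIdeal I := by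
  intro d
  rw [coeff_nodePartV]
  split_ifs
  · exact hF _
  · exact I.zero_mem

/-- `[·]ᵤᵥ` preserves "all coefficients in `I`". [folklore] -/
theorem nodePartUV_mem_coeffIdeal {I : Ideal Λ} {F : MvPowerSeries (Fin 2) Λ}
    (hF : F ∈ MvPowerSeries.coeffIdeal I) : nodePartUV F ∈ MvPowerSeries.coeffIdeal I :=
  fun _ => hF _

/-- Coefficients of `u · G` (`u = X 0`). [folklore] -/
theorem coeff_X_zero_mul (G : MvPowerSeries (Fin 2) Λ) (d : Fin 2 →₀ ℕ) :
    MvPowerSeries.coeff d (MvPowerSeries.X 0 * G) =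
      if Finsupp.single 0 1 ≤ d then MvPowerSeries.coeff (d - Finsupp.single 0 1) G else 0 := by
  rw [MvPowerSeries.X_def, MvPowerSeries.coeff_monomial_mul, one_mul]

/-- Coefficients of `v · G` (`v = X 1`). [folklore] -/
theorem coeff_X_one_mul (G : MvPowerSeries (Fin 2) Λ) (d : Fin 2 →₀ ℕ) :
    MvPowerSeries.coeff d (MvPowerSeries.X 1 * G) =
      if Finsupp.single 1 1 ≤ d then MvPowerSeries.coeff (d - Finsupp.single 1 1) G else 0 := by
  rw [MvPowerSeries.X_def, MvPowerSeries.coeff_monomial_mul, one_mul]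

/-- Coefficients of `uv · G`. [folklore] -/
theorem coeff_X_zero_mul_X_one_mul (G : MvPowerSeries (Fin 2) Λ) (d : Fin 2 →₀ ℕ) :
    MvPowerSeries.coeff d (MvPowerSeries.X 0 * MvPowerSeries.X 1 * G) =
      if Finsupp.single 0 1 + Finsupp.single 1 1 ≤ d then
        MvPowerSeries.coeff (d - (Finsupp.single 0 1 + Finsupp.single 1 1)) G else 0 := by
  rw [MvPowerSeries.X_def, MvPowerSeries.X_def, MvPowerSeries.monomial_mul_monomial, one_mul,
    MvPowerSeries.coeff_monomial_mul, one_mul]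

/-! ### Bookkeeping on exponents `d : Fin 2 →₀ ℕ` -/

/-- `e_u + e_v ≤ d` iff both `u` and `v` occur in the monomial `d`. [folklore] -/
theorem fin2_single_add_single_le_iff (d : Fin 2 →₀ ℕ) :
    Finsupp.single (0 : Fin 2) 1 + Finsupp.single 1 1 ≤ d ↔ 1 ≤ d 0 ∧ 1 ≤ d 1 := by
  rw [Finsupp.le_def]
  constructor
  · intro h
    exact ⟨by simpa using h 0, by simpa using h 1⟩
  · rintro ⟨h0, h1⟩ i
    fin_cases i
    · simpa using h0
    · simpa using h1

/-- `(d - e_u)_v = d_v`. [folklore] -/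
theorem fin2_tsub_single_zero_apply_one (d : Fin 2 →₀ ℕ) :
    (d - Finsupp.single (0 : Fin 2) 1 : Fin 2 →₀ ℕ) 1 = d 1 := by
  simp

/-- `(d - e_v)_u = d_u`. [folklore] -/
theorem fin2_tsub_single_one_apply_zero (d : Fin 2 →₀ ℕ) :
    (d - Finsupp.single (1 : Fin 2) 1 : Fin 2 →₀ ℕ) 0 = d 0 := by
  simp

/-- `(d - (e_u + e_v)) + e_u + e_v = d` when both `u` and `v` occur in `d`. [folklore] -/
theorem fin2_tsub_add_cancel (d : Fin 2 →₀ ℕ) (h0 : d 0 ≠ 0) (h1 : d 1 ≠ 0) :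
    d - (Finsupp.single (0 : Fin 2) 1 + Finsupp.single 1 1) + Finsupp.single 0 1 +
      Finsupp.single 1 1 = d := by
  rw [add_assoc]
  exact tsub_add_cancel_of_le ((fin2_single_add_single_le_iff d).mpr
    ⟨Nat.one_le_iff_ne_zero.mpr h0, Nat.one_le_iff_ne_zero.mpr h1⟩)

/-- `(d - e_u) + e_u = d` when `u` occurs in `d`. [folklore] -/
theorem fin2_tsub_single_zero_add_cancel (d : Fin 2 →₀ ℕ) (h0 : d 0 ≠ 0) :
    d - Finsupp.single (0 : Fin 2) 1 + Finsupp.single 0 1 = d :=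
  tsub_add_cancel_of_le (Finsupp.single_le_iff.mpr (Nat.one_le_iff_ne_zero.mpr h0))

/-- `(d - e_v) + e_v = d` when `v` occurs in `d`. [folklore] -/
theorem fin2_tsub_single_one_add_cancel (d : Fin 2 →₀ ℕ) (h1 : d 1 ≠ 0) :
    d - Finsupp.single (1 : Fin 2) 1 + Finsupp.single 1 1 = d :=
  tsub_add_cancel_of_le (Finsupp.single_le_iff.mpr (Nat.one_le_iff_ne_zero.mpr h1))

/-- A monomial in which neither `u` nor `v` occurs is the constant monomial. [folklore] -/
theorem fin2_eq_zero (d : Fin 2 →₀ ℕ) (h0 : d 0 = 0) (h1 : d 1 = 0) : d = 0 := by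
  ext i
  fin_cases i
  · simpa using h0
  · simpa using h1

/-- **The decomposition** `F = F₀₀ + u·[F]ᵤ + v·[F]ᵥ + uv·[F]ᵤᵥ` of a power series in two
variables according to which of `u`, `v` occur. [folklore] -/
theorem node_decompose (F : MvPowerSeries (Fin 2) Λ) :
    F = MvPowerSeries.C (MvPowerSeries.constantCoeff F) + MvPowerSeries.X 0 * nodePartU F +
      MvPowerSeries.X 1 * nodePartV F + MvPowerSeries.X 0 * MvPowerSeries.X 1 * nodePartUV F := by
  classical
  ext d
  simp only [map_add, MvPowerSeries.coeff_C, coeff_X_zero_mul, coeff_X_one_mul,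
    coeff_X_zero_mul_X_one_mul, coeff_nodePartU, coeff_nodePartV, coeff_nodePartUV,
    Finsupp.single_le_iff, fin2_single_add_single_le_iff, fin2_tsub_single_zero_apply_one,
    fin2_tsub_single_one_apply_zero]
  by_cases h0 : d 0 = 0 <;> by_cases h1 : d 1 = 0
  · -- the constant term
    have hd : d = 0 := fin2_eq_zero d h0 h1
    subst hd
    simp
  · -- `v` occurs, `u` does not: only the `v`-part contributes
    have hd : d ≠ 0 := fun h => h1 (by rw [h]; rfl)
    simp [hd, h0, h1, Nat.one_le_iff_ne_zero, fin2_tsub_single_one_add_cancel d h1]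
  · -- `u` occurs, `v` does not: only the `u`-part contributes
    have hd : d ≠ 0 := fun h => h0 (by rw [h]; rfl)
    simp [hd, h0, h1, Nat.one_le_iff_ne_zero, fin2_tsub_single_zero_add_cancel d h0]
  · -- both occur: only the `uv`-part contributes
    have hd : d ≠ 0 := fun h => h0 (by rw [h]; rfl)
    simp [hd, h0, h1, Nat.one_le_iff_ne_zero, fin2_tsub_add_cancel d h0 h1]

/-! ## The contraction -/

/-- `N(α, β, ε) = H + αβ + εH`. [folklore] -/
def morseN (H : MvPowerSeries (Fin 2) Λ)
    (x : MvPowerSeries (Fin 2) Λ × MvPowerSeries (Fin 2) Λ × MvPowerSeries (Fin 2) Λ) :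
    MvPowerSeries (Fin 2) Λ :=
  H + x.1 * x.2.1 + x.2.2 * H

/-- The contraction `Θ(α, β, ε) = (-[N]ᵥ, -[N]ᵤ, [N]ᵤᵥ)`, `N = H + αβ + εH`. [folklore] -/
def morseStep (H : MvPowerSeries (Fin 2) Λ)
    (x : MvPowerSeries (Fin 2) Λ × MvPowerSeries (Fin 2) Λ × MvPowerSeries (Fin 2) Λ) :
    MvPowerSeries (Fin 2) Λ × MvPowerSeries (Fin 2) Λ × MvPowerSeries (Fin 2) Λ :=
  (-nodePartV (morseN H x), -nodePartU (morseN H x), nodePartUV (morseN H x))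

/-- The iterates `Θⁿ(0)`. [folklore] -/
def morseSeq (H : MvPowerSeries (Fin 2) Λ) (n : ℕ) :
    MvPowerSeries (Fin 2) Λ × MvPowerSeries (Fin 2) Λ × MvPowerSeries (Fin 2) Λ :=
  (morseStep H)^[n] (0, 0, 0)

/-- `Θⁿ⁺¹(0) = Θ(Θⁿ(0))`. [folklore] -/
theorem morseSeq_succ (H : MvPowerSeries (Fin 2) Λ) (n : ℕ) :
    morseSeq H (n + 1) = morseStep H (morseSeq H n) :=
  Function.iterate_succ_apply' _ _ _

/-- "All three components have coefficients in `I`". [folklore] -/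
def TripleMem (I : Ideal Λ)
    (x : MvPowerSeries (Fin 2) Λ × MvPowerSeries (Fin 2) Λ × MvPowerSeries (Fin 2) Λ) : Prop :=
  x.1 ∈ MvPowerSeries.coeffIdeal I ∧ x.2.1 ∈ MvPowerSeries.coeffIdeal I ∧
    x.2.2 ∈ MvPowerSeries.coeffIdeal I

/-- If `H` and `α` have coefficients in `𝔪` then so does `N(α, β, ε)`. [folklore] -/
theorem morseN_mem_coeffIdeal {𝔪 : Ideal Λ} {H : MvPowerSeries (Fin 2) Λ}
    (hH : H ∈ MvPowerSeries.coeffIdeal 𝔪)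
    {x : MvPowerSeries (Fin 2) Λ × MvPowerSeries (Fin 2) Λ × MvPowerSeries (Fin 2) Λ}
    (hx : x.1 ∈ MvPowerSeries.coeffIdeal 𝔪) : morseN H x ∈ MvPowerSeries.coeffIdeal 𝔪 := by
  unfold morseN
  refine Ideal.add_mem _ (Ideal.add_mem _ hH (Ideal.mul_mem_right _ _ hx))
    (Ideal.mul_mem_left _ _ hH)

/-- `Θ` maps triples into triples with coefficients in `𝔪` (given `H`, `α` with coefficients
in `𝔪`). [folklore] -/
theorem tripleMem_morseStep {𝔪 : Ideal Λ} {H : MvPowerSeries (Fin 2) Λ}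
    (hH : H ∈ MvPowerSeries.coeffIdeal 𝔪)
    {x : MvPowerSeries (Fin 2) Λ × MvPowerSeries (Fin 2) Λ × MvPowerSeries (Fin 2) Λ}
    (hx : x.1 ∈ MvPowerSeries.coeffIdeal 𝔪) : TripleMem 𝔪 (morseStep H x) := by
  have hN := morseN_mem_coeffIdeal hH hx
  exact ⟨neg_mem (nodePartV_mem_coeffIdeal hN), neg_mem (nodePartU_mem_coeffIdeal hN),
    nodePartUV_mem_coeffIdeal hN⟩

/-- **The contraction estimate for `N`**: if `α, β'` and `H` have coefficients in `𝔪` and the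
triples `(α, β, ε)`, `(α', β', ε')` agree coefficientwise modulo `J`, then
`N(α, β, ε) - N(α', β', ε') = α(β - β') + (α - α')β' + (ε - ε')H` has coefficients in `𝔪J`.
[folklore] -/
theorem coeffIdeal_morseN_sub {𝔪 J : Ideal Λ} {H : MvPowerSeries (Fin 2) Λ}
    (hH : H ∈ MvPowerSeries.coeffIdeal 𝔪)
    {x x' : MvPowerSeries (Fin 2) Λ × MvPowerSeries (Fin 2) Λ × MvPowerSeries (Fin 2) Λ}
    (hx : x.1 ∈ MvPowerSeries.coeffIdeal 𝔪) (hx' : x'.2.1 ∈ MvPowerSeries.coeffIdeal 𝔪)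
    (h1 : x.1 - x'.1 ∈ MvPowerSeries.coeffIdeal J)
    (h2 : x.2.1 - x'.2.1 ∈ MvPowerSeries.coeffIdeal J)
    (h3 : x.2.2 - x'.2.2 ∈ MvPowerSeries.coeffIdeal J) :
    morseN H x - morseN H x' ∈ MvPowerSeries.coeffIdeal (𝔪 * J) := by
  have e : morseN H x - morseN H x' =
      x.1 * (x.2.1 - x'.2.1) + (x.1 - x'.1) * x'.2.1 + (x.2.2 - x'.2.2) * H := by
    unfold morseN
    ring
  rw [e]
  refine Ideal.add_mem _ (Ideal.add_mem _ (MvPowerSeries.mul_mem_coeffIdeal_mul hx h2) ?_) ?_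
  · have := MvPowerSeries.mul_mem_coeffIdeal_mul h1 hx'
    rwa [Ideal.mul_comm] at this
  · have := MvPowerSeries.mul_mem_coeffIdeal_mul h3 hH
    rwa [Ideal.mul_comm] at this

/-- **The contraction estimate for `Θ`**: under the same hypotheses, `Θ(x) - Θ(x')` has
coefficients in `𝔪J` componentwise. [folklore] -/
theorem tripleMem_morseStep_sub {𝔪 J : Ideal Λ} {H : MvPowerSeries (Fin 2) Λ}
    (hH : H ∈ MvPowerSeries.coeffIdeal 𝔪)
    {x x' : MvPowerSeries (Fin 2) Λ × MvPowerSeries (Fin 2) Λ × MvPowerSeries (Fin 2) Λ}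
    (hx : x.1 ∈ MvPowerSeries.coeffIdeal 𝔪) (hx' : x'.2.1 ∈ MvPowerSeries.coeffIdeal 𝔪)
    (h1 : x.1 - x'.1 ∈ MvPowerSeries.coeffIdeal J)
    (h2 : x.2.1 - x'.2.1 ∈ MvPowerSeries.coeffIdeal J)
    (h3 : x.2.2 - x'.2.2 ∈ MvPowerSeries.coeffIdeal J) :
    TripleMem (𝔪 * J) (morseStep H x - morseStep H x') := by
  have hN := coeffIdeal_morseN_sub hH hx hx' h1 h2 h3
  refine ⟨?_, ?_, ?_⟩
  · show -nodePartV (morseN H x) - -nodePartV (morseN H x') ∈ _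
    have e : -nodePartV (morseN H x) - -nodePartV (morseN H x') =
        -nodePartV (morseN H x - morseN H x') := by
      rw [nodePartV_sub]; ring
    rw [e]
    exact neg_mem (nodePartV_mem_coeffIdeal hN)
  · show -nodePartU (morseN H x) - -nodePartU (morseN H x') ∈ _
    have e : -nodePartU (morseN H x) - -nodePartU (morseN H x') =
        -nodePartU (morseN H x - morseN H x') := by
      rw [nodePartU_sub]; ring
    rw [e]
    exact neg_mem (nodePartU_mem_coeffIdeal hN)
  · show nodePartUV (morseN H x) - nodePartUV (morseN H x') ∈ _
    rw [← nodePartUV_sub]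
    exact nodePartUV_mem_coeffIdeal hN

/-- The iterates have coefficients in `𝔪`. [folklore] -/
theorem tripleMem_morseSeq {𝔪 : Ideal Λ} {H : MvPowerSeries (Fin 2) Λ}
    (hH : H ∈ MvPowerSeries.coeffIdeal 𝔪) (n : ℕ) : TripleMem 𝔪 (morseSeq H n) := by
  induction n with
  | zero => exact ⟨Ideal.zero_mem _, Ideal.zero_mem _, Ideal.zero_mem _⟩
  | succ n ih =>
    rw [morseSeq_succ]
    exact tripleMem_morseStep hH ih.1

/-- Consecutive iterates agree modulo `𝔪ⁿ⁺¹` coefficientwise. [folklore] -/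
theorem tripleMem_morseSeq_succ_sub {𝔪 : Ideal Λ} {H : MvPowerSeries (Fin 2) Λ}
    (hH : H ∈ MvPowerSeries.coeffIdeal 𝔪) (n : ℕ) :
    TripleMem (𝔪 ^ (n + 1)) (morseSeq H (n + 1) - morseSeq H n) := by
  induction n with
  | zero =>
    have h := tripleMem_morseSeq hH 1
    simp only [zero_add, pow_one]
    simpa [morseSeq, TripleMem] using h
  | succ n ih =>
    have hx := tripleMem_morseSeq hH (n + 1)
    have hx' := tripleMem_morseSeq hH n
    have h := tripleMem_morseStep_sub (J := 𝔪 ^ (n + 1)) hH hx.1 hx'.2.1 ih.1 ih.2.1 ih.2.2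
    rw [← morseSeq_succ H n, ← morseSeq_succ H (n + 1), ← pow_succ'] at h
    exact h

/-- Iterates `m ≤ n` agree modulo `𝔪ᵐ` coefficientwise. [folklore] -/
theorem tripleMem_morseSeq_sub {𝔪 : Ideal Λ} {H : MvPowerSeries (Fin 2) Λ}
    (hH : H ∈ MvPowerSeries.coeffIdeal 𝔪) {m n : ℕ} (hmn : m ≤ n) :
    TripleMem (𝔪 ^ m) (morseSeq H n - morseSeq H m) := by
  induction n, hmn using Nat.le_induction with
  | base => simp [TripleMem]
  | succ n hmn ih =>
    have h := tripleMem_morseSeq_succ_sub hH n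
    have hle : 𝔪 ^ (n + 1) ≤ 𝔪 ^ m := Ideal.pow_le_pow_right (by omega)
    have e : morseSeq H (n + 1) - morseSeq H m =
        (morseSeq H (n + 1) - morseSeq H n) + (morseSeq H n - morseSeq H m) := by abel
    rw [e]
    refine ⟨Ideal.add_mem _ (MvPowerSeries.coeffIdeal_mono hle h.1) ih.1,
      Ideal.add_mem _ (MvPowerSeries.coeffIdeal_mono hle h.2.1) ih.2.1,
      Ideal.add_mem _ (MvPowerSeries.coeffIdeal_mono hle h.2.2) ih.2.2⟩

/-! ## Coefficientwise limits -/

/-- **Coefficientwise limits in `Λ⟦u, v⟧` over an `𝔪`-adically complete `Λ`.** A sequence of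
power series whose `m`-th and `n`-th terms (`m ≤ n`) agree coefficientwise modulo `𝔪ᵐ` has a
coefficientwise limit: a series agreeing with the `n`-th term modulo `𝔪ⁿ` for every `n`.
[folklore] -/
theorem exists_coeffwise_limit {σ : Type v} (𝔪 : Ideal Λ) [IsPrecomplete 𝔪 Λ]
    (F : ℕ → MvPowerSeries σ Λ)
    (hF : ∀ {m n : ℕ}, m ≤ n → F n - F m ∈ MvPowerSeries.coeffIdeal (𝔪 ^ m)) :
    ∃ L : MvPowerSeries σ Λ, ∀ n, L - F n ∈ MvPowerSeries.coeffIdeal (𝔪 ^ n) := by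
  have hlim : ∀ d : σ →₀ ℕ, ∃ l : Λ, ∀ n, l - MvPowerSeries.coeff d (F n) ∈ 𝔪 ^ n := by
    intro d
    obtain ⟨l, hl⟩ := IsPrecomplete.prec (inferInstance : IsPrecomplete 𝔪 Λ)
      (f := fun n => MvPowerSeries.coeff d (F n)) (fun {m n} hmn => by
        rw [smodEq_pow_smul_top_iff, ← neg_mem_iff, neg_sub, ← map_sub]
        exact hF hmn d)
    refine ⟨l, fun n => ?_⟩
    have h := hl n
    rw [smodEq_pow_smul_top_iff, ← neg_mem_iff, neg_sub] at h
    exact h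
  choose l hl using hlim
  refine ⟨fun d => l d, fun n d => ?_⟩
  rw [map_sub]
  exact hl d n

/-- In an `𝔪`-adically separated `Λ`, a power series with coefficients in every `𝔪ⁿ` is zero.
[folklore] -/
theorem eq_zero_of_forall_mem_coeffIdeal_pow {σ : Type v} (𝔪 : Ideal Λ) [IsHausdorff 𝔪 Λ]
    {F : MvPowerSeries σ Λ} (hF : ∀ n, F ∈ MvPowerSeries.coeffIdeal (𝔪 ^ n)) : F = 0 := by
  ext d
  rw [map_zero]
  refine IsHausdorff.haus (inferInstance : IsHausdorff 𝔪 Λ) _ fun n => ?_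
  rw [smodEq_pow_smul_top_iff, sub_zero]
  exact hF n d

/-! ## The formal Morse lemma -/

/-- **The formal Morse lemma for the node `uv` (de Jong 1996, 2.23: "Rechoosing the
coordinates `u, v ∈ B` appropriately, using that `discr(q) ≠ 0`, we see that we may assume
`h ∈ A'`").** Let `Λ` be complete and separated in its `𝔪`-adic topology and let
`H ∈ Λ⟦u, v⟧` have all its coefficients in `𝔪`. Then there are `α, β, ε ∈ Λ⟦u, v⟧` with all
coefficients in `𝔪` and `h ∈ 𝔪` with `(1 + ε)(uv - H) = (u + α)(v + β) - h`; in particular, in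
`Λ⟦u, v⟧/(uv - H)` the new coordinates `u + α`, `v + β` have product `h ∈ Λ`. Proof:
the limit of the iterates of the contraction `Θ` is a fixed point `(α, β, ε)`,
i.e. `N = H + αβ + εH` has `[N]ᵥ = -α`, `[N]ᵤ = -β`, `[N]ᵤᵥ = ε`; with `h = N₀₀` the
decomposition `N = h - uβ - vα + uvε` is the identity. [cite: DeJong1996, 2.23, p. 61] -/
theorem exists_formalMorse_node (𝔪 : Ideal Λ) [IsAdicComplete 𝔪 Λ]
    (H : MvPowerSeries (Fin 2) Λ) (hH : ∀ d, MvPowerSeries.coeff d H ∈ 𝔪) :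
    ∃ (α β ε : MvPowerSeries (Fin 2) Λ) (h : Λ),
      (∀ d, MvPowerSeries.coeff d α ∈ 𝔪) ∧ (∀ d, MvPowerSeries.coeff d β ∈ 𝔪) ∧
      (∀ d, MvPowerSeries.coeff d ε ∈ 𝔪) ∧ h ∈ 𝔪 ∧
      (1 + ε) * (MvPowerSeries.X 0 * MvPowerSeries.X 1 - H) =
        (MvPowerSeries.X 0 + α) * (MvPowerSeries.X 1 + β) - MvPowerSeries.C h := by
  have hH' : H ∈ MvPowerSeries.coeffIdeal 𝔪 := hH
  -- the three coefficientwise limits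
  have hdiff := fun {m n : ℕ} (hmn : m ≤ n) => tripleMem_morseSeq_sub hH' hmn
  obtain ⟨α, hα⟩ := exists_coeffwise_limit 𝔪 (fun n => (morseSeq H n).1)
    (fun hmn => by simpa using (hdiff hmn).1)
  obtain ⟨β, hβ⟩ := exists_coeffwise_limit 𝔪 (fun n => (morseSeq H n).2.1)
    (fun hmn => by simpa using (hdiff hmn).2.1)
  obtain ⟨ε, hε⟩ := exists_coeffwise_limit 𝔪 (fun n => (morseSeq H n).2.2)
    (fun hmn => by simpa using (hdiff hmn).2.2)
  -- they have coefficients in `𝔪`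
  have hmem : ∀ {L : MvPowerSeries (Fin 2) Λ} {G : MvPowerSeries (Fin 2) Λ},
      L - G ∈ MvPowerSeries.coeffIdeal (𝔪 ^ 1) → G ∈ MvPowerSeries.coeffIdeal 𝔪 →
        L ∈ MvPowerSeries.coeffIdeal 𝔪 := fun {L G} h hG => by
    rw [pow_one] at h
    simpa using Ideal.add_mem _ h hG
  have h1 := tripleMem_morseSeq hH' 1
  have hαm : α ∈ MvPowerSeries.coeffIdeal 𝔪 := hmem (hα 1) h1.1
  have hβm : β ∈ MvPowerSeries.coeffIdeal 𝔪 := hmem (hβ 1) h1.2.1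
  have hεm : ε ∈ MvPowerSeries.coeffIdeal 𝔪 := hmem (hε 1) h1.2.2
  -- the limit is a fixed point of `Θ`
  set x : MvPowerSeries (Fin 2) Λ × MvPowerSeries (Fin 2) Λ × MvPowerSeries (Fin 2) Λ :=
    (α, β, ε) with hx
  have hfix : morseStep H x = x := by
    have hcomp : ∀ n, TripleMem (𝔪 ^ (n + 1)) (morseStep H x - x) := fun n => by
      have hxn := tripleMem_morseSeq hH' n
      -- `Θ(x) - Θ(xₙ)` has coefficients in `𝔪 · 𝔪ⁿ`
      have hstep : TripleMem (𝔪 * 𝔪 ^ n) (morseStep H x - morseStep H (morseSeq H n)) :=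
        tripleMem_morseStep_sub hH' hαm hxn.2.1 (hα n) (hβ n) (hε n)
      rw [← pow_succ'] at hstep
      -- `Θ(xₙ) - x = xₙ₊₁ - x` has coefficients in `𝔪ⁿ⁺¹`
      have e : morseStep H x - x =
          (morseStep H x - morseStep H (morseSeq H n)) + (morseSeq H (n + 1) - x) := by
        rw [morseSeq_succ]; abel
      rw [e]
      refine ⟨Ideal.add_mem _ hstep.1 ?_, Ideal.add_mem _ hstep.2.1 ?_,
        Ideal.add_mem _ hstep.2.2 ?_⟩
      · have h := neg_mem (hα (n + 1)); rwa [neg_sub] at h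
      · have h := neg_mem (hβ (n + 1)); rwa [neg_sub] at h
      · have h := neg_mem (hε (n + 1)); rwa [neg_sub] at h
    have hzero : ∀ {G : MvPowerSeries (Fin 2) Λ},
        (∀ n, G ∈ MvPowerSeries.coeffIdeal (𝔪 ^ (n + 1))) → G = 0 := fun {G} hG =>
      eq_zero_of_forall_mem_coeffIdeal_pow 𝔪 fun n =>
        MvPowerSeries.coeffIdeal_mono (Ideal.pow_le_pow_right (Nat.le_succ n)) (hG n)
    have e1 : (morseStep H x).1 - x.1 = 0 := hzero fun n => (hcomp n).1
    have e2 : (morseStep H x).2.1 - x.2.1 = 0 := hzero fun n => (hcomp n).2.1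
    have e3 : (morseStep H x).2.2 - x.2.2 = 0 := hzero fun n => (hcomp n).2.2
    rw [sub_eq_zero] at e1 e2 e3
    exact Prod.ext e1 (Prod.ext e2 e3)
  -- read off the identity
  set N := morseN H x with hN
  have hNmem : N ∈ MvPowerSeries.coeffIdeal 𝔪 := morseN_mem_coeffIdeal hH' hαm
  have eα : α = -nodePartV N := (congrArg Prod.fst hfix).symm
  have eβ : β = -nodePartU N := (congrArg (fun y => y.2.1) hfix).symm
  have eε : ε = nodePartUV N := (congrArg (fun y => y.2.2) hfix).symm
  have eN : N = H + α * β + ε * H := rfl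
  have hdec := node_decompose N
  refine ⟨α, β, ε, MvPowerSeries.constantCoeff N, hαm, hβm, hεm,
    MvPowerSeries.constantCoeff_mem_of_mem_coeffIdeal hNmem, ?_⟩
  linear_combination (-1 : MvPowerSeries (Fin 2) Λ) * hdec - MvPowerSeries.X 1 * eα -
    MvPowerSeries.X 0 * eβ + MvPowerSeries.X 0 * MvPowerSeries.X 1 * eε + eN

end DeJong1996

end Literature.AlgebraicGeometry.Resolution

end
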